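import Literature.Geometry.Lorentzian.LorentzBoost
import Literature.Geometry.Lorentzian.KerrConvergenceProofs
import Summits.FinalStateConjecture.FinalStateConjecture.Theorems.EIHFluxBalanceInertialRecessionLorentz

/-!
# Route EIHFluxBalance — `InertialRecession`: the Schwarzschild summand depends only on the painted velocity

Helper file for the crux `stmt-FinalStateConjecture-10166`
(`Summit.FinalStateConjecture.FinalStateConjecture.Theses.EIHFluxBalance.InertialRecession`).

The crux hypothesis paints each hole with an arbitrary smooth Lorentz path `Λᵢ(t) ∈ O(1,3)`, but
the reference field only sees `Λᵢ(t)` through the coset of the Kerr–Schild STABILISER: for a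
Schwarzschild hole (`a = 0`) the form `g_{M,0} = η + (2M/r) ℓ ⊗ ℓ`, `ℓ = (1, x̲/r)`, is
invariant under every Lorentz map fixing the time axis `e₀` (`kerr_bilin_zero_spin_invariant`:
such a map preserves time components, spatial inner products and `r = ‖x̲‖`), hence

  `boostedKerrBilin (Λ·R) c M 0 = boostedKerrBilin Λ c M 0` whenever `R e₀ = e₀`
  (`boostedKerrBilin_mul_of_apply_basisVector_zero`),

and consequently the painted summand equals the one painted with the PURE BOOST of the same lab
velocity `v(Λ) = (Λe₀)~/(Λe₀)⁰` (`boostedKerrBilin_eq_boost_boostVelocity`, for future-pointing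
`Λe₀`; `Literature.Geometry.Lorentzian.Lorentz.boost` of `LorentzBoost.lean`). This is the FRAME
NORMALISATION that turns the line's slaving statements (which control `Λᵢe₀`, not `Λᵢ`) into the
bounded-derivative frame paths required by the flat-chart estimate
`tendsto_deviationCk_flat_of_ansatz` (file `…FlatChart`), for Schwarzschild holes: replace `Λᵢ`
by `t ↦ boost (v(Λᵢ(t)))` without changing the reference field. (Rotating holes need the axis
`Λᵢe₃` as well; not treated here.)
-/

noncomputable section

open Literature.Geometry.Lorentzian

namespace Summit.FinalStateConjecture.FinalStateConjecture.Theorems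

/-! ### Schwarzschild Kerr–Schild data in terms of `η` and the spatial inner product -/

/-- For `a = 0` the Kerr–Schild covector is `ℓ(y)(v) = v⁰ + ⟪ỹ, ṽ⟫/‖ỹ‖` off the axis of time
(Kerr–Schild 1965; Visser arXiv:0706.0622, (33)–(34) with `a = 0`). [cite: KerrSchild1965, §2] -/
theorem nullCovector_zero_spin_apply {y : E4} (hy : E4.spatialNorm y ≠ 0) (v : E4) :
    Kerr.nullCovector 0 y v = v 0 + inner ℝ (E4.spatial y) (E4.spatial v) / E4.spatialNorm y := by
  have hr : Kerr.radius 0 y = E4.spatialNorm y := Kerr.radius_zero_left y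
  have hinner : inner ℝ (E4.spatial y) (E4.spatial v) = y 1 * v 1 + y 2 * v 2 + y 3 * v 3 := by
    rw [show inner ℝ (E4.spatial y) (E4.spatial v) = ∑ i : Fin 3, inner ℝ (E4.spatial y i)
      (E4.spatial v i) from PiLp.inner_apply _ _, Fin.sum_univ_three]
    simp only [E4.spatial_apply, Fin.succ_zero_eq_one, Fin.succ_one_eq_two, real_inner_eq_re_inner]
    rw [show (2 : Fin 3).succ = (3 : Fin 4) from rfl]
    simp [mul_comm]
  rw [hinner, Kerr.nullCovector, E4.covector_apply, Fin.sum_univ_four, Kerr.nullCovectorFun]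
  simp only [Matrix.cons_val_zero, Matrix.cons_val_one, Matrix.cons_val, hr, zero_mul,
    add_zero, sub_zero, one_mul, zero_pow two_ne_zero]
  field_simp
  ring

/-- For `a = 0` the Kerr–Schild scalar is `H = M/‖ỹ‖` (Visser arXiv:0706.0622, (33) with `a = 0`).
[cite: KerrSchild1965, §2] -/
theorem scalarH_zero_spin {y : E4} (hy : E4.spatialNorm y ≠ 0) (M : ℝ) :
    Kerr.scalarH M 0 y = M / E4.spatialNorm y := by
  have hr : Kerr.radius 0 y = E4.spatialNorm y := Kerr.radius_zero_left y
  rw [Kerr.scalarH, hr]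
  field_simp
  ring

/-- The Schwarzschild Kerr–Schild form applied: `g_{M,0}(y)(v, w) = η(v, w) + 2H(y) ℓ(y)(v) ℓ(y)(w)`
(Kerr–Schild 1965, §2). [cite: KerrSchild1965, §2] -/
theorem kerr_bilin_apply_eq (M a : ℝ) (y v w : E4) :
    Kerr.bilin M a y v w = Minkowski.bilin v w +
      2 * Kerr.scalarH M a y * Kerr.nullCovector a y v * Kerr.nullCovector a y w := by
  have h := Kerr.ksPert_eq M a y
  have h2 := congrArg (fun T : E4 →L[ℝ] E4 →L[ℝ] ℝ ↦ T v w) h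
  simp only [sub_apply, smul_apply, E4.tmul_apply, smul_eq_mul] at h2
  linarith

/-! ### Lorentz maps fixing the time axis -/

/-- A Lorentz map fixing `e₀` preserves time components: `(R v)⁰ = v⁰` (`v⁰ = −η(e₀, v)`).
O'Neill 1983, Ch. 9, p. 233. [folklore] -/
theorem apply_zero_eq_of_apply_basisVector_zero {R : lorentzGroup}
    (hR : (R : E4 ≃L[ℝ] E4) (E4.basisVector 0) = E4.basisVector 0) (v : E4) :
    ((R : E4 ≃L[ℝ] E4) v) 0 = v 0 := by
  have h1 := minkowski_bilin_basisVector_zero_left ((R : E4 ≃L[ℝ] E4) v)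
  have h2 := minkowski_bilin_basisVector_zero_left v
  have h3 := R.2 (E4.basisVector 0) v
  rw [hR] at h3
  linarith

/-- A Lorentz map fixing `e₀` preserves spatial inner products: `⟪(Ry)~, (Rv)~⟫ = ⟪ỹ, ṽ⟫`
(`⟪ỹ, ṽ⟫ = η(y, v) + y⁰v⁰`). O'Neill 1983, Ch. 9, p. 233. [folklore] -/
theorem inner_spatial_eq_of_apply_basisVector_zero {R : lorentzGroup}
    (hR : (R : E4 ≃L[ℝ] E4) (E4.basisVector 0) = E4.basisVector 0) (y v : E4) :
    inner ℝ (E4.spatial ((R : E4 ≃L[ℝ] E4) y)) (E4.spatial ((R : E4 ≃L[ℝ] E4) v)) =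
      inner ℝ (E4.spatial y) (E4.spatial v) := by
  have h1 := Lorentz.minkowski_bilin_eq_inner ((R : E4 ≃L[ℝ] E4) y) ((R : E4 ≃L[ℝ] E4) v)
  have h2 := Lorentz.minkowski_bilin_eq_inner y v
  have h3 := R.2 y v
  rw [apply_zero_eq_of_apply_basisVector_zero hR, apply_zero_eq_of_apply_basisVector_zero hR] at h1
  linarith

/-- A Lorentz map fixing `e₀` preserves the spatial radius: `‖(Ry)~‖ = ‖ỹ‖`. O'Neill 1983, Ch. 9,
p. 233. [folklore] -/
theorem spatialNorm_eq_of_apply_basisVector_zero {R : lorentzGroup}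
    (hR : (R : E4 ≃L[ℝ] E4) (E4.basisVector 0) = E4.basisVector 0) (y : E4) :
    E4.spatialNorm ((R : E4 ≃L[ℝ] E4) y) = E4.spatialNorm y := by
  have h := inner_spatial_eq_of_apply_basisVector_zero hR y y
  rw [real_inner_self_eq_norm_sq, real_inner_self_eq_norm_sq] at h
  have h1 : 0 ≤ E4.spatialNorm ((R : E4 ≃L[ℝ] E4) y) := E4.spatialNorm_nonneg _
  have h2 : 0 ≤ E4.spatialNorm y := E4.spatialNorm_nonneg _
  unfold E4.spatialNorm at *
  nlinarith

/-- **The Schwarzschild Kerr–Schild form is invariant under Lorentz maps fixing the time axis**: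
`g_{M,0}(Ry)(Rv, Rw) = g_{M,0}(y)(v, w)` (spherical symmetry of Schwarzschild in Kerr–Schild
Cartesian coordinates; on the axis `ỹ = 0` both sides are `η`). Kerr–Schild 1965, §2. [cite: KerrSchild1965, §2] -/
theorem kerr_bilin_zero_spin_invariant {R : lorentzGroup}
    (hR : (R : E4 ≃L[ℝ] E4) (E4.basisVector 0) = E4.basisVector 0) (M : ℝ) (y v w : E4) :
    Kerr.bilin M 0 ((R : E4 ≃L[ℝ] E4) y) ((R : E4 ≃L[ℝ] E4) v) ((R : E4 ≃L[ℝ] E4) w) =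
      Kerr.bilin M 0 y v w := by
  rw [kerr_bilin_apply_eq, kerr_bilin_apply_eq, R.2 v w]
  rcases eq_or_ne (E4.spatialNorm y) 0 with hy | hy
  · -- on the time axis both perturbations vanish (`H = 0` by the junk value `M·0³/0 = 0`)
    have hy' : E4.spatialNorm ((R : E4 ≃L[ℝ] E4) y) = 0 := by
      rw [spatialNorm_eq_of_apply_basisVector_zero hR, hy]
    have hH : ∀ z : E4, E4.spatialNorm z = 0 → Kerr.scalarH M 0 z = 0 := fun z hz ↦ by
      rw [Kerr.scalarH, Kerr.radius_zero_left, hz]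
      simp
    rw [hH _ hy', hH _ hy]
    ring
  · have hy' : E4.spatialNorm ((R : E4 ≃L[ℝ] E4) y) ≠ 0 := by
      rwa [spatialNorm_eq_of_apply_basisVector_zero hR]
    rw [scalarH_zero_spin hy', scalarH_zero_spin hy, nullCovector_zero_spin_apply hy',
      nullCovector_zero_spin_apply hy', nullCovector_zero_spin_apply hy,
      nullCovector_zero_spin_apply hy, spatialNorm_eq_of_apply_basisVector_zero hR,
      inner_spatial_eq_of_apply_basisVector_zero hR, inner_spatial_eq_of_apply_basisVector_zero hR,
      apply_zero_eq_of_apply_basisVector_zero hR, apply_zero_eq_of_apply_basisVector_zero hR]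

/-! ### The stabiliser freedom of the painted Schwarzschild summand -/

/-- The inverse of a product of Lorentz maps, applied (bookkeeping in
`ContinuousLinearEquiv.automorphismGroup`: `(Λ·R)⁻¹ v = R⁻¹(Λ⁻¹ v)`). [folklore] -/
theorem lorentz_mul_symm_apply (Λ R : lorentzGroup) (v : E4) :
    ((Λ * R : lorentzGroup) : E4 ≃L[ℝ] E4).symm v =
      (R : E4 ≃L[ℝ] E4).symm ((Λ : E4 ≃L[ℝ] E4).symm v) := rfl

/-- `R⁻¹` fixes `e₀` when `R` does (bookkeeping). [folklore] -/
theorem symm_apply_basisVector_zero_of_apply {R : lorentzGroup}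
    (hR : (R : E4 ≃L[ℝ] E4) (E4.basisVector 0) = E4.basisVector 0) :
    ((R⁻¹ : lorentzGroup) : E4 ≃L[ℝ] E4) (E4.basisVector 0) = E4.basisVector 0 := by
  rw [coe_lorentz_inv]
  conv_lhs => rw [← hR]
  exact (R : E4 ≃L[ℝ] E4).symm_apply_apply _

/-- **Stabiliser freedom of the painted Schwarzschild summand**: right-multiplying the motion by a
Lorentz map fixing `e₀` does not change `boostedKerrBilin Λ c M 0` (pull back the invariance
`kerr_bilin_zero_spin_invariant` of `R⁻¹`). Consequence: the crux's painted frame path `Λᵢ(t)` of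
a Schwarzschild hole matters only through its 4-velocity `Λᵢ(t)e₀`. Kerr–Schild 1965, §2.
[cite: KerrSchild1965, §2] -/
theorem boostedKerrBilin_mul_of_apply_basisVector_zero' (Λ : lorentzGroup) {R : lorentzGroup}
    (hR : (R : E4 ≃L[ℝ] E4) (E4.basisVector 0) = E4.basisVector 0) (c : E4) (M : ℝ) (x : E4) :
    boostedKerrBilin (Λ * R) c M 0 x = boostedKerrBilin Λ c M 0 x := by
  refine ContinuousLinearMap.ext fun v ↦ ContinuousLinearMap.ext fun w ↦ ?_
  rw [boostedKerrBilin_apply, boostedKerrBilin_apply, poincareInv, poincareInv,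
    lorentz_mul_symm_apply, lorentz_mul_symm_apply, lorentz_mul_symm_apply]
  have h := kerr_bilin_zero_spin_invariant (symm_apply_basisVector_zero_of_apply hR) M
    ((Λ : E4 ≃L[ℝ] E4).symm (x - c)) ((Λ : E4 ≃L[ℝ] E4).symm v) ((Λ : E4 ≃L[ℝ] E4).symm w)
  rw [coe_lorentz_inv] at h
  exact h

/-! ### Normalising the frame to the pure boost of the painted velocity -/

/-- The lab velocity of a Lorentz map with future-pointing `Λe₀` is subluminal:
`‖(Λe₀)~/(Λe₀)⁰‖ < 1` (from `((Λe₀)⁰)² = 1 + ‖(Λe₀)~‖²`). O'Neill 1983, Ch. 9, p. 233. [folklore] -/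
theorem norm_boostVelocity_lt_one (Λ : lorentzGroup)
    (h : 0 < ((Λ : E4 ≃L[ℝ] E4) (E4.basisVector 0)) 0) :
    ‖(((Λ : E4 ≃L[ℝ] E4) (E4.basisVector 0)) 0)⁻¹ •
      E4.spatial ((Λ : E4 ≃L[ℝ] E4) (E4.basisVector 0))‖ < 1 := by
  have h1 := lorentz_apply_zero_sq Λ
  rw [norm_smul, norm_inv, Real.norm_of_nonneg h.le]
  rw [inv_mul_lt_iff₀ h, mul_one]
  have h2 : 0 ≤ E4.spatialNorm ((Λ : E4 ≃L[ℝ] E4) (E4.basisVector 0)) := E4.spatialNorm_nonneg _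
  unfold E4.spatialNorm at h1 h2
  nlinarith

/-- The pure boost of the painted velocity has the same 4-velocity: `boost(v(Λ)) e₀ = Λ e₀` for
future-pointing `Λe₀` (both are `(γ, γv)` with `γ² (1 − ‖v‖²) = 1`, `γ > 0`). O'Neill 1983, Ch. 9.
[folklore] -/
theorem boost_boostVelocity_apply_basisVector_zero (Λ : lorentzGroup)
    (h : 0 < ((Λ : E4 ≃L[ℝ] E4) (E4.basisVector 0)) 0) :
    (Lorentz.boost _ (norm_boostVelocity_lt_one Λ h) : E4 ≃L[ℝ] E4) (E4.basisVector 0) =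
      (Λ : E4 ≃L[ℝ] E4) (E4.basisVector 0) := by
  have hv1 : ‖(((Λ : E4 ≃L[ℝ] E4) (E4.basisVector 0)) 0)⁻¹ •
      E4.spatial ((Λ : E4 ≃L[ℝ] E4) (E4.basisVector 0))‖ < 1 := norm_boostVelocity_lt_one Λ h
  -- the Lorentz factor of `v` is `(Λe₀)⁰`
  have hsq := lorentz_apply_zero_sq Λ
  have hnv : ‖(((Λ : E4 ≃L[ℝ] E4) (E4.basisVector 0)) 0)⁻¹ •
      E4.spatial ((Λ : E4 ≃L[ℝ] E4) (E4.basisVector 0))‖ ^ 2 =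
      (((Λ : E4 ≃L[ℝ] E4) (E4.basisVector 0)) 0)⁻¹ ^ 2 *
        E4.spatialNorm ((Λ : E4 ≃L[ℝ] E4) (E4.basisVector 0)) ^ 2 := by
    rw [norm_smul, norm_inv, Real.norm_of_nonneg h.le, mul_pow, E4.spatialNorm]
  have hg : Lorentz.gamma ((((Λ : E4 ≃L[ℝ] E4) (E4.basisVector 0)) 0)⁻¹ •
      E4.spatial ((Λ : E4 ≃L[ℝ] E4) (E4.basisVector 0))) =
      ((Λ : E4 ≃L[ℝ] E4) (E4.basisVector 0)) 0 := by
    have h1 := Lorentz.gamma_sq_mul hv1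
    have h2 := Lorentz.gamma_pos hv1
    have hne : ((Λ : E4 ≃L[ℝ] E4) (E4.basisVector 0)) 0 ≠ 0 := h.ne'
    have h4 : 1 - ‖(((Λ : E4 ≃L[ℝ] E4) (E4.basisVector 0)) 0)⁻¹ •
        E4.spatial ((Λ : E4 ≃L[ℝ] E4) (E4.basisVector 0))‖ ^ 2 =
        (((Λ : E4 ≃L[ℝ] E4) (E4.basisVector 0)) 0)⁻¹ ^ 2 := by
      rw [hnv]
      field_simp
      linarith
    rw [h4] at h1
    generalize hG : Lorentz.gamma ((((Λ : E4 ≃L[ℝ] E4) (E4.basisVector 0)) 0)⁻¹ •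
        E4.spatial ((Λ : E4 ≃L[ℝ] E4) (E4.basisVector 0))) = G at h1 h2 ⊢
    generalize hγ : ((Λ : E4 ≃L[ℝ] E4) (E4.basisVector 0)) 0 = γ₀ at h1 hne h ⊢
    have h3 : G ^ 2 = γ₀ ^ 2 := by
      calc G ^ 2 = G ^ 2 * γ₀⁻¹ ^ 2 * γ₀ ^ 2 := by
            rw [inv_pow, mul_assoc, inv_mul_cancel₀ (pow_ne_zero 2 hne), mul_one]
        _ = γ₀ ^ 2 := by rw [h1, one_mul]
    nlinarith [h2, h]
  rw [Lorentz.boost_apply_basisVector_zero, hg, smul_smul, mul_inv_cancel₀ h.ne', one_smul]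
  conv_rhs => rw [← E4.ofTimeSpace_time_spatial ((Λ : E4 ≃L[ℝ] E4) (E4.basisVector 0))]
  rfl

/-- **Frame normalisation for a Schwarzschild hole**: for a motion `Λ` with future-pointing
`Λe₀`, the painted summand equals the one painted with the pure boost of its lab velocity,
`boostedKerrBilin Λ c M 0 = boostedKerrBilin (boost v(Λ)) c M 0` (`Λ = boost(v(Λ))·R` with
`R e₀ = e₀`, and the stabiliser freedom `boostedKerrBilin_mul_of_apply_basisVector_zero'`). Hence a smooth painted path `Λ(t)` may be replaced by
`t ↦ boost(v(Λ(t)))`, whose derivatives are controlled by those of the 4-velocity `Λ(t)e₀` alone.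
Kerr–Schild 1965, §2; O'Neill 1983, Ch. 9. [cite: KerrSchild1965, §2] -/
theorem boostedKerrBilin_eq_boost_boostVelocity (Λ : lorentzGroup)
    (h : 0 < ((Λ : E4 ≃L[ℝ] E4) (E4.basisVector 0)) 0) (c : E4) (M : ℝ) (x : E4) :
    boostedKerrBilin Λ c M 0 x =
      boostedKerrBilin (Lorentz.boost _ (norm_boostVelocity_lt_one Λ h)) c M 0 x := by
  set B : lorentzGroup := Lorentz.boost _ (norm_boostVelocity_lt_one Λ h) with hB
  have hR : ((B⁻¹ * Λ : lorentzGroup) : E4 ≃L[ℝ] E4) (E4.basisVector 0) = E4.basisVector 0 := by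
    change (B : E4 ≃L[ℝ] E4).symm ((Λ : E4 ≃L[ℝ] E4) (E4.basisVector 0)) = E4.basisVector 0
    rw [← boost_boostVelocity_apply_basisVector_zero Λ h, ← hB]
    exact (B : E4 ≃L[ℝ] E4).symm_apply_apply _
  have hmul : Λ = B * (B⁻¹ * Λ) := by group
  conv_lhs => rw [hmul]
  exact boostedKerrBilin_mul_of_apply_basisVector_zero' B hR c M x

/-- Registered sub-goal form (stub `boostedKerrBilin_mul_of_apply_basisVector_zero` of the crux item)
of `boostedKerrBilin_mul_of_apply_basisVector_zero'`. Kerr–Schild 1965, §2. [cite: KerrSchild1965, §2] -/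
theorem boostedKerrBilin_mul_of_apply_basisVector_zero : open Literature.Geometry.Lorentzian in ∀ (Λ : lorentzGroup) {R : lorentzGroup}, (R : E4 ≃L[ℝ] E4) (E4.basisVector 0) = E4.basisVector 0 → ∀ (c : E4) (M : ℝ) (x : E4), boostedKerrBilin (Λ * R) c M 0 x = boostedKerrBilin Λ c M 0 x :=
  fun Λ _ hR c M x ↦ boostedKerrBilin_mul_of_apply_basisVector_zero' Λ hR c M x

end Summit.FinalStateConjecture.FinalStateConjecture.Theorems

end
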